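import Mathlib
import HarnessLib
import Summits.NavierStokesRegularity.NavierStokesRegularity.Theses.QuarterLogPincer
import Summits.NavierStokesRegularity.NavierStokesRegularity.Theorems.QuarterLogPincerThinCascadeDefs
import Summits.NavierStokesRegularity.NavierStokesRegularity.Theorems.TypeIQuantSubcubicExp.Negative.ThinCascadeEnvelopeSplit
import Summits.NavierStokesRegularity.NavierStokesRegularity.Theorems.LerayQuarterDissipationFiniteDissipationLiouvilleHardness
import Summits.NavierStokesRegularity.NavierStokesRegularity.Theorems.TypeIQuarterGateScarEnvelopeTypeISatelliteTowerEnvelopeDefs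
import Summits.NavierStokesRegularity.NavierStokesRegularity.Theorems.QuarterLogPincerTruncationEdgeDefs
import Summits.NavierStokesRegularity.NavierStokesRegularity.Theorems.QuarterLogPincerTruncationEdgeAnatomyDefs
import Summits.NavierStokesRegularity.NavierStokesRegularity.Theorems.QuarterLogPincerTruncationEdgeCutoffData
import Summits.NavierStokesRegularity.NavierStokesRegularity.Theorems.QuarterLogPincerTruncationEdgeExteriorCube
import Summits.NavierStokesRegularity.NavierStokesRegularity.Theorems.QuarterLogPincerTruncationEdgeSupShadowingCore
import Summits.NavierStokesRegularity.NavierStokesRegularity.Theorems.QuarterLogPincerTypeIQuantSubcubicExpTruncationEdgeStubs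
import Summits.NavierStokesRegularity.NavierStokesRegularity.Theorems.QuarterLogPincerTruncationEdgeCore
import Summits.NavierStokesRegularity.NavierStokesRegularity.Theorems.QuarterLogPincerTruncationEdgeTransfer
import Summits.NavierStokesRegularity.NavierStokesRegularity.Theorems.QuarterLogPincerTruncationEdgeFrameBootstrap
import Summits.NavierStokesRegularity.NavierStokesRegularity.Theorems.QuarterLogPincerTruncationEdgeProfileIntegration
import Summits.NavierStokesRegularity.NavierStokesRegularity.Theorems.QuarterLogPincerTruncationEdgeSupShadowingGlue
import Summits.NavierStokesRegularity.NavierStokesRegularity.Theorems.QuarterLogPincerTruncationEdgeAnatomy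
import Summits.NavierStokesRegularity.NavierStokesRegularity.Theorems.QuarterLogPincerTruncationEdgeT1
import Summits.NavierStokesRegularity.NavierStokesRegularity.Theorems.QuarterLogPincerTruncationEdgeProfileHelpers
import Summits.NavierStokesRegularity.NavierStokesRegularity.Theorems.QuarterLogPincerTruncationEdgeSupShadowingProfile
import Literature.Analysis.FluidPDE.SelfSimilar
import Literature.Analysis.FluidPDE.TypeIAncientMild
import Literature.Probability.Distributions.GaussianSphereMarginal
import Literature.Analysis.FluidPDE.KNSSLocalSmoothingHolds
import Literature.Analysis.FluidPDE.OseenMildUniqueness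
import Literature.Analysis.FluidPDE.ClassicalSupStabilityMild
import Literature.Analysis.FluidPDE.NSBoundedMildSmoothing
import Literature.Analysis.FluidPDE.ClassicalSolutionGlue
import Literature.Analysis.FluidPDE.ForcedOseenRepresentationClassical
import Literature.Analysis.FluidPDE.ClassicalNSBlowupAlternative
import Literature.Analysis.FluidPDE.BoundedMildSpatialDecay

/-!
# Line `truncation-edge` for crux `QuarterLogPincer.TypeIQuantSubcubicExp` (stmt-NavierStokesRegularity-24077)

ns-idea-7 g8–g9 (lens «nearmiss», target «DSS wall»).  EDGE LINE (calibration polarity): it does not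
attack the crux, it PLACES it — kernel-checked and, since v1.9, WITH NO REMAINING OBLIGATION (no `sorry` in this
file: the pieces P1, P2, P3a, P4, the P3b′ ⇒ P3b integration and T3, T4 are imported from LANDED `Theorems/`
files — P2 and the integration being this line's own v1.6/v1.7 proofs re-homed verbatim by the pub-ns-dss typer —,
while a twin proof of P3a, the proof of P3b′ and every composition are below; v1.9.1): the crux 24077
implies the envelope-class Type-I Liouville wall (route items 22144 `FiniteDissipationLiouville`,
24453 `AsymmetricFlickerLiouville`, 24374 `PerpetualFlickerLiouville`, the enveloped exclusion (E1⁺)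
`¬ EnvelopedLeaf M A` of 23843's factorisation, and the catalogued conjecture leaf
`TypeIDSSLiouvilleConjecture`, every `λ`).  No summit is proved by this line; 24077, 22144, 24453,
24374, 23843, the DSS wall and Navier–Stokes regularity are OPEN.

## The near-miss of record and its measured deficit (technique: nearmiss autopsy)

* Barker–Prange 2021 (arXiv:2003.06717 = CMP 385), abstract p. 1 and Cor. 1 pp. 3–4 [corpus
  paper:arxiv-2003.06717 p.1 L18, p.3 L39–L48, p.4 L1–6]: the Type-I quantitative rate is «optimal for a
  certain class of potential non-zero backward discretely self-similar solutions» — for a non-zero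
  `λ`-DSS solution `∫_{B(1)}|u(t)|³ ≤ M³ log(2/√(−t))` (LOG cube budget) while `‖u(t)‖_∞ ≳ 1/√(−t)`.
  Their optimality transfer is carried out INSIDE the infinite-energy class: «the framework of ‘smooth
  solutions with enough decay’ is needed to apply Theorem 1 to the setting of Corollary 1, where the
  solution is not of finite energy» (p. 3 L21).
* The tree's Negative lane `Theorems/TypeIQuantSubcubicExp/Negative/ThinCascadeLiouvilleHardness.lean`
  (module docstring, «Scope, honestly»): a Type-I DSS profile «does NOT refute the crux 24077 itself (a
  statement about finite-energy smooth solutions on `[0,T]`), only the registered line through S3».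
* MEASURED DEFICIT = the finite-energy frame: the crux is typed over Tao-frame solutions (classical on
  the CLOSED interval `[0,T]`, every `H^k` seminorm bounded), the optimality witnesses are infinite-energy
  ancient objects.  SINGLE INPUT = **finite-time far-field truncation stability** (T1 below): on
  `[−1, −ε]` an enveloped Type-I ancient mild solution is shadowed, up to `δ` on the unit ball, by a
  Tao-frame solution issued from its Bogovskiĭ-corrected cut-off at radius `R(ε) ≤ K ε^{−κ}`
  (POLYNOMIAL in `1/ε`: dyadic Gronwall, the Type-I drift `M/√(−s)` costs `exp(O(M²))` per dyadic
  block, `log₂(1/ε)` blocks), whose `L³` norm exceeds the localised slice norm by at most an excess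
  `k` with `k³ ≤ K·(1 + log R + log(1/ε))` (v1.1, critic N1 / backstop PE-2: the excess is NOT asked
  `ε`- and `R`-uniform — `‖u(0)‖₂² ~ A²R` and the exterior `L³` mass are only log-controlled; the
  arithmetic core absorbs the same log shape as T3's budget).

## Why the cube, and why `o(A³)` is exactly the wall (the arithmetic core, PROVED below)

With the envelope `‖v(s,x)‖ ≤ A/(‖x‖+√(−s))` the localised cube is `∫_{B(R)}|v(s)|³ ≤ 4πA³(1/3 +
log(R/√(−s)))`, so the truncated solution on `[0, 1−ε]` has `‖u(t)‖₃³ ≤ K₁ + K₂ log(1/ε)`; the Leray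
floor at the singular apex gives `‖u(1−ε, x_ε)‖ ≥ c/(2√ε)` at a point `‖x_ε‖ < 1`; the crux at Type-I
constant `M+1` (virtual blow-up time `T + τ = 1`) then forces `F(A) ≥ (c/4) ε^{−1/2} ≥ (c/4)
exp((A³ − K₁)/(2K₂))` along `A³ = K₁ + K₂ log(1/ε)`, contradicting `F(A) ≤ exp(A³/(4K₂))` for large
`A` (`not_quantSubcubicExpAt_of_truncatedFamily`).  So the SUBCUBIC exponent of 24077 is precisely the
statement that no enveloped singular Type-I ancient object (log cube budget, `√(−s)`-rate floor) exists:
LIOUVILLE (rate class, tree `typeIQuantSubcubicExp_of_rateLiouville`) ⇒ 24077 ⇒ LIOUVILLE (envelope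
class, this line) — the residual of W7 over the wall is at most «rate class minus envelope class».

## Registered obligations — ALL DISCHARGED (v1.9: no `sorry` in this file)

* T1 `stub_farFieldTruncation : StubFarFieldTruncation` — THE INPUT (finite-time, no blow-up, no stable
  manifold: NOT route DssFarFieldSlaving's `DssTruncationBridge`).  **v1.4: a THEOREM modulo its
  ANATOMY** `stubFarFieldTruncation_of_anatomy : P1 → P2 → P3 → P4 → T1` (kernel-checked), the four
  pieces being the registered stubs
  - P1 `stub_cutoffData : StubCutoffData` — Bogovskiĭ-corrected cut-off data at radius `ρ`: smooth,
    div-free, `tsupport ⊆ B̄(2ρ)`, `sup‖u₀ − v(−1)‖ ≤ K/ρ`, `‖u₀‖₂² ≤ Kρ` (standard; size M) —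
    **LANDED BY NAME (pub-ns-dss typer g35, `Theorems/QuarterLogPincerTruncationEdgeCutoffData.lean`,
    via the cone-potential divergence-free truncation `exists_divFree_truncation` of
    `…TruncationEdgeDivFreeTruncation.lean`), imported here since v1.9;**
  - P2 `stub_frameBootstrap : StubFrameBootstrap` — NS-generic continuation of a Tao-frame solution
    under a self-improving sup-closeness barrier to a continuous bounded decaying reference field —
    **PROVED in v1.6** (`frameBootstrap_holds`: the tree's Leray alternative for smooth finite-energy
    data `finiteEnergy_classical_dichotomy` (global on closed slabs, or a maximal solution with
    UNBOUNDED velocity), Tao's persistence of regularity, and a connectedness argument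
    `frame_close_of_improvement` — infimum of the bad times, uniform spatial decay of frame solutions
    `exists_forall_norm_le_of_datum_decay`, uniform continuity on the compact cylinder; the
    `δ`-closeness caps the velocity by `sup|V| + δ` and excludes the blow-up branch before `T`);
  - P3 `stub_supShadowing : StubSupShadowing` — the a priori sup shadowing of `v(·−1)` with
    POLYNOMIAL loss `ε^{−κ(M)}`, no loss outside `B(ρ)`, and the log-shaped `L³(B̄(2ρ))` budget of
    the difference.  **v1.5: P3 = P3a ∘ P3b (`stubSupShadowing_of_parts`, kernel-checked) with the
    Type-I-specific core P3a `StubSupShadowingCore` PROVED** (`supShadowingCore_of_isTypeIAncientMild`: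
    dyadic restart of the tree's mild sup-stability core `sup_stability_mild_core` — on the block
    `[1−2^{−j}, 1−2^{−j−1}]` the reference `v(·−1)` is bounded by `M2^{(j+1)/2}`, the block costs the
    SCALE-INVARIANT factor `G(M) = 2exp(36C₀²(8M₊²+9))`, restarting the Oseen integral equation at
    the block boundary carries no memory, and `2^j ≤ 1/ε` turns `G^j` into `ε^{−log₂G}`); the only
    remaining sorry of P3 is the localisation P3b `stub_supShadowingLocal : StubSupShadowingLocal`
    (outer profile + `L³` budget given global `δ'`-closeness; standard given the envelope; size M) —
    **v1.7: P3b = P3b′ ∘ (PROVED profile integration `supShadowingLocal_of_profile`)**, the remaining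
    sorry being the POINTWISE profile `stub_supShadowingProfile : StubSupShadowingProfile`
    (`‖u(t,x) − v(t−1,x)‖ ≤ K/ρ + K/(‖x‖+1)`); **v1.8: P3b′ PROVED**
    (`supShadowingProfile_of_isTypeIAncientMild`: the difference `w = u − v(·−1)` solves a.e.
    `w(t) = e^{tΔ}w₀ − B(w,u) − B(v(·−1),w)`; at `‖x‖ ≥ 3R/2` the sources are split at radius `R`:
    NEAR sources see the kernel decay `(R/2)^{−4}` and carry the TIME-INTEGRABLE Type-I rate
    `M/√(1−τ)` (`∫₀ᵗ ≤ 2M`, uniformly in `T' < 1`), FAR sources carry the ENVELOPE `A/‖y‖ ≤ A/R` and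
    the bootstrap size `δ₀`, coefficient `2C₁(2A/R + δ₀) ≤ 1/4` for `R ≥ r₀ = max(2, 32C₁A)`,
    `δ₀ ≤ 1/(16C₁+1)`; induction over `R = r₀2^n`, a.e. ⇒ everywhere on the open exterior by
    continuity; measurability-free two-region slice/Duhamel lemmas `norm_oseenSlice_two_region`,
    `norm_oseenDuhamel_two_region`) — so **P3 `SupShadowing` is now a THEOREM** (no sorry below it);
  - P4 `stub_exteriorCube : StubExteriorCube` — NS-generic exterior `L³` control of a frame solution
    from data supported in `B̄(2ρ)` with a small outer sup bound — **LANDED BY NAME (typer g35,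
    `Theorems/QuarterLogPincerTruncationEdgeExteriorCube.lean`: for the statement as typed, INTERPOLATION
    `∫_{|x|>2ρ}|u(t)|³ ≤ (K₀/ρ)·‖u(t)‖₂² ≤ K₀K₁` with the Tao-frame energy inequality
    `taoFrame_lintegral_enorm_sq_le` suffices — no heat leakage), imported here since v1.9.**
  P3a is ALSO landed by name (`Theorems/QuarterLogPincerTruncationEdgeSupShadowingCore.lean`, typer g35, read
  off the importable polynomial stability estimate `exists_oseenMild_sub_le_of_typeI`; this file keeps its
  own proof `stubSupShadowingCore_holds`).
  FINDING (v1.4): no piece contains open mathematics — the removed tail `(1−χ_ρ)v(−1)` is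
  `L^∞`-small (`≤ A/ρ`), so GLOBAL sup shadowing is an elementary singular Gronwall estimate and the
  loss `ε^{−κ(M)}` is paid by `ρ = K ε^{−κ}` (v1.5: this part is now KERNEL-PROVED, P3a); only the
  `L³` budget needs localisation (critical `L³`: the `ρ`-powers cancel, unweighted `L^p` shadowing
  cannot give it).  T1 is a theorem-in-waiting; its Type-I-specific content is discharged.
  **v1.9: T1 `stub_farFieldTruncation : StubFarFieldTruncation` IS A THEOREM (sorry-free, this file,
  over the landed objects of `Theorems/QuarterLogPincerTruncationEdge{Defs,AnatomyDefs}.lean`).**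
* T3 `stub_envelopeCubeBudget : StubEnvelopeCubeBudget` — **PROVED in v1.2** (no longer a stub: polar
  coordinates `lintegral_fun_norm_addHaar`, `y²/(y+δ)³ ≤ 1/(y+δ)`, `∫₀ᴿ dy/(y+δ) = log((R+δ)/δ)`;
  `B = 3·|B₁|·A³`; = BP21 Cor. 1 upper bound for DSS).  The name is kept so the composition is unchanged.
* T4 `stub_rateFloor : StubRateFloor` — Leray's 1934 floor `‖v(s)‖_∞ ≥ c/√(−s)` in the KNSS gauge —
  **PROVED in v1.3** (`rateFloor_of_isTypeIAncientMild_of_singularAt`: the bounded local theory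
  `knss2009_local_smoothing_holds` (KNSS 2009 Prop. 4.1, lifespan `ε/‖a‖_∞²`) + uniqueness of bounded
  solutions of the Oseen integral equation `oseenMild_bounded_unique` on every `(s₀, T₁)`, `T₁ < 0`,
  a.e. ⇒ everywhere by continuity; `c = √ε`).  The name is kept so the composition is unchanged.

## Kernel-checked (no sorry) — v1.9: EVERY declaration of this file; in particular T1 `stub_farFieldTruncation`
and the obligation-free edges of § v1.9 at the end: `typeIQuantSubcubicExp_implies_envelopeLiouville`,
`typeIQuantSubcubicExp_implies_finiteDissipationLiouville` (24077 ⇒ 22144), `…_implies_asymmetricFlickerLiouville`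
(⇒ 24453), `…_implies_perpetualFlickerLiouville` (⇒ 24374), `…_implies_typeIDSSLiouvilleConjecture` /
`…_implies_typeIDSSLiouville` (⇒ the catalogued DSS wall, every `λ`), `…_implies_noEnvelopedLeaf` ((E1⁺) of 23843),
`isTypeIDSSProfile_refutes_typeIQuantSubcubicExp` (THE INSTRUMENT ROW: any Type-I (rotated) `λ`-DSS profile
refutes 24077 — now a theorem with no side obligation), `envelopedSingular_refutes_typeIQuantSubcubicExp`.
Earlier record: `supShadowingProfile_of_isTypeIAncientMild` / `stubSupShadowingProfile_holds`
(= P3b′, v1.8; with `norm_oseenSlice_two_region`, `norm_oseenDuhamel_two_region`, `setIntegral_rate_le`,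
`volume_real_ball_eq`, `forall_norm_le_of_ae_norm_le_on'`), `supShadowingLocal_of_profile` /
`stubSupShadowingLocal_of_profile` (P3b′ ⇒ P3b, v1.7), `envelopeCubeBudget_explicit`, `frame_close_of_improvement`, `frameBootstrap_holds` /
`stubFrameBootstrap_holds` (= P2, v1.6), `block_shadow`, `supShadowingCore_of_isTypeIAncientMild` /
`stubSupShadowingCore_holds` (= P3a, v1.5), `supShadowing_of_core_of_local` / `stubSupShadowing_of_parts`
(P3 = P3a ∘ P3b, v1.5), `farFieldTruncation_of_anatomy` / `stubFarFieldTruncation_of_anatomy`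
(= T1 from P1–P4, v1.4: `ρ = (K₃+ρ₀+2K₁/δ+1)ε^{−κ}`, `R = 2ρ`, `k = k₃ + k₄`, the `L³` split
`u(t) = 1_B v(t−1) + 1_B (u(t)−v(t−1)) + 1_{Bᶜ} u(t)` with the null sphere, the virtual Type-I bound
`δ + M(1−t)^{−1/2} ≤ (M+1)(1−t)^{−1/2}`), `rateFloor_of_isTypeIAncientMild_of_singularAt` (= T4, v1.3),
`envelopeCubeBudget_of_hasTypeIDecay` (= T3, v1.2),
`not_quantSubcubicExpAt_of_truncatedFamily` (arithmetic core),
`truncatedFamily_of_parts`, `envelopeLiouville_of_typeIQuantSubcubicExp` (THE EDGE),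
`finiteDissipationLiouville_of_typeIQuantSubcubicExp` (⇒ item 22144 BY NAME),
`asymmetricFlickerLiouville_of_…` (24453), `perpetualFlickerLiouville_of_…` (24374),
`typeIDSSLiouvilleConjecture_of_…` / `typeIDSSLiouville_of_…` (the catalogued wall, every `λ`),
`noEnvelopedLeaf_of_…` ((E1⁺) of 23843), `not_typeIQuantSubcubicExp_of_isTypeIDSSProfile` (THE
INSTRUMENT ROW: any Type-I (rotated) `λ`-DSS profile kills 24077, modulo T1/T3/T4), and the v1.4
compositions over the four pieces `FiniteDissipationLiouville_of₀`,
`envelopeLiouville_of_typeIQuantSubcubicExp₀`, `not_typeIQuantSubcubicExp_of_isTypeIDSSProfile₀`.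

bears_on: LADDER-NS W7 (24077 over core 10661) / H2; instrument row = backward-DSS profile census
(pub-ns-dss; negatives: locally-DSS collar class EMPTY p593102 does not bear — no collar here).

v1.1 (2026-08-28, after idea-crit-4 PASS 18:45:39Z + idea-crit-7 backstop 18:47:24Z): T1 clause (ii)
retyped with a log-shaped excess `k³ ≤ K(1 + log R + log(1/ε))` (N1 / PE-2; `truncatedFamily_of_parts`
re-proved with `K₁ = 32 + 16(B+K)(1 + log K)`, `K₂ = 16(B+K)(κ+1) + 1`); provenance tags on every
declaration (PE-4); the pen lemma for the falsifier (PE-3) is in the card `Lines/truncation-edge.md`.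
v1.2/v1.3 (2026-08-28): T3, T4 proved in-file (and landed in `Theorems/` by nsreg-C26, same names).
v1.4 (2026-08-28, ns-idea-7 g9): T1 ANATOMY — `StubFarFieldTruncation` derived (kernel-checked) from
four NS-standard typed pieces P1 `CutoffData`, P2 `FrameBootstrap`, P3 `SupShadowing`, P4
`ExteriorCube`; the sorries of the file are exactly `stub_cutoffData`, `stub_frameBootstrap`,
`stub_supShadowing`, `stub_exteriorCube`; every edge is unchanged BY NAME.
v1.5 (2026-08-28, ns-idea-7 g9): P3 split as P3a `SupShadowingCore` (Type-I rate ⇒ polynomial-loss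
global sup shadowing) ∘ P3b `SupShadowingLocal` (envelope ⇒ outer profile + `L³` budget), glue
`stubSupShadowing_of_parts` kernel-checked, and **P3a PROVED** (`supShadowingCore_of_isTypeIAncientMild`,
by dyadic restart of the tree's `sup_stability_mild_core`); the sorries of the file are exactly
`stub_cutoffData` (P1), `stub_frameBootstrap` (P2), `stub_supShadowingLocal` (P3b), `stub_exteriorCube`
(P4) — none of them Type-I-specific.
v1.6 (2026-08-28, ns-idea-7 g9): **P2 PROVED** (`frameBootstrap_holds`); the sorries of the file are
exactly `stub_cutoffData` (P1: quantitative Bogovskiĭ cut-off), `stub_supShadowingLocal` (P3b: two-region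
localisation) and `stub_exteriorCube` (P4: exterior `L³` control) — T1 = P1 ∘ P2 ∘ P3a ∘ P3b ∘ P4 with
P2, P3a proved.
v1.7 (2026-08-28, ns-idea-7 g9): P3b reduced to the POINTWISE profile P3b′ `StubSupShadowingProfile`
(`‖u(t,x) − v(t−1,x)‖ ≤ K/ρ + K/(‖x‖+1)`) by the PROVED profile integration
`supShadowingLocal_of_profile` (T3's polar-coordinate computation, now with explicit constant
`envelopeCubeBudget_explicit`, applied to the frozen localised slice; `‖x‖+1 ≤ 3ρ` on `B̄(2ρ)`); sorries =
`stub_cutoffData` (P1), `stub_supShadowingProfile` (P3b′), `stub_exteriorCube` (P4).  No summit is proved.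
v1.8 (2026-08-28, ns-idea-7 g9): **P3b′ PROVED** (`supShadowingProfile_of_isTypeIAncientMild`, dyadic-radius
bootstrap: near sources × kernel decay × time-integrable RATE, far sources × ENVELOPE × bootstrap size),
hence P3 = P3a ∘ P3b′ is sorry-free: the whole shadowing step of T1 — the only place where the Type-I
rate AND envelope enter — is kernel-proved.  Sorries = `stub_cutoffData` (P1: quantitative Bogovskiĭ
cut-off; NS-generic vector calculus) and `stub_exteriorCube` (P4: exterior `L³` control of a frame solution
from compactly supported data; NS-generic).  No summit is proved by this line.
v1.9 (2026-08-28 ≈22:00Z, ns-idea-7 g9): REBASED on the landed modules `Theorems/QuarterLogPincerTruncationEdge{Defs,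
AnatomyDefs,Core,Transfer,CutoffData,ExteriorCube,SupShadowingCore}.lean` and `…TypeIQuantSubcubicExpTruncationEdge
{Stubs,EnvelopeCubeBudget,RateFloor}.lean` (every object/theorem of this line that the landing hands nsreg-C26 / pub-ns-dss
typer g35 re-homed or proved BY NAME is now IMPORTED, not re-declared: 51 declarations removed, none changed); with the
landed P1 `stub_cutoffData` and P4 `stub_exteriorCube` the composition closes: **NO `sorry` IN THIS FILE — T1
`stub_farFieldTruncation` is a theorem and every edge of the line holds with no side obligation** (§ v1.9).  What this
means, honestly: the IMPLICATIONS «24077 ⇒ envelope-class Type-I Liouville / 22144 / 24453 / 24374 / DSS wall / (E1⁺)» and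
«any Type-I λ-DSS profile ⇒ ¬24077» are kernel theorems over tree objects; 24077 itself, 22144, the DSS wall and
Navier–Stokes regularity remain OPEN.  No summit is proved.
v1.9.1 (2026-08-28 22:05Z): second rebase after the typer landed `…TruncationEdgeFrameBootstrap.lean` (P2 BY NAME = §v1.6 verbatim) and
`…TruncationEdgeProfileIntegration.lean` (§v1.7 verbatim): 14 more twins deleted, both modules imported; still NO `sorry`; T1 and the
§v1.9 edges unchanged BY NAME (axioms standard).  Remaining in-file mathematics: the P3a twin (§v1.5) and P3b′ (§v1.8), plus the compositions.
v1.9.2 (2026-08-28 22:36Z): third rebase after the typer landed `…TruncationEdge{SupShadowingGlue, Anatomy, ProfileHelpers,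
SupShadowingProfile}.lean` (the glue, the anatomy composition, and the P3b′ port = §v1.8 re-homed; critic idea-crit-4 g6 RECORD
22:08:19Z booked v1.9 as kernel-replayed with 0 sorries): 13 twins deleted, the P3a twin (§v1.5) dropped in favour of the LANDED
`stub_supShadowingCore`, orphan helpers removed; the file is now the compositions BY NAME + the § v1.9 edges only (≈400 lines,
NO `sorry`, no in-file analysis left).  When `…TruncationEdgeT1.lean` (announced 22:28Z: `stub_farFieldTruncation` BY NAME) lands,
the three `stub_supShadowingLocal` / `stub_supShadowing` / `stub_farFieldTruncation` compositions below become twins to delete too.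
v1.9.3 (2026-08-28 23:05Z): fourth rebase after the typer landed `…TruncationEdgeT1.lean` (22:38Z; T1 `stub_farFieldTruncation` and
P3 `stub_supShadowing` BY NAME, plus the by-name edges `edge_{finiteDissipationLiouville, envelopeLiouville,
typeIDSSLiouvilleConjecture, noEnvelopedLeaf}` and `not_typeIQuantSubcubicExp_of_isTypeIDSSProfile'`): the 2 twins deleted, T1 imported;
lean check rc 0 · 0 errors · 0 sorries · 0 warnings.  EVERYTHING this line registered (P1–P4, P3a, P3b′, T1, T3, T4) is now a landed
`Theorems/` theorem; the file keeps `stub_supShadowingLocal` (derived), the family assembly and the §v1.9 edges as a record.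
-/

noncomputable section

set_option linter.dupNamespace false

namespace Summit.NavierStokesRegularity.NavierStokesRegularity.Cruxes.TypeIQuantSubcubicExp.TruncationEdge

open MeasureTheory Set Function Metric Filter Topology
open scoped ENNReal NNReal
open Literature.Analysis Literature.Analysis.FluidPDE
open Summit.NavierStokesRegularity.NavierStokesRegularity.Cruxes.TypeIQuantSubcubicExp.ThinCascade
  (TaoFrame ThinObject SingularAt)
open Summit.NavierStokesRegularity.NavierStokesRegularity.Cruxes.ScarEnvelopeTypeI.ZoomDictionary
  (ABTower RegPt EnvelopedLeaf)

/-! ### v1.9.2 — every piece of T1's anatomy (P1 `stub_cutoffData`, P2 `stub_frameBootstrap`, P3a `stub_supShadowingCore`,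
P3b′ `stub_supShadowingProfile` + the profile integration, P4 `stub_exteriorCube`), the glue `stubSupShadowing_of_parts` /
`stubFarFieldTruncation_of_anatomy`, T3 `stub_envelopeCubeBudget`, T4 `stub_rateFloor` and the family/transfer core are LANDED
`Theorems/` modules (imported above, same names).  This file keeps only the compositions BY NAME and the § v1.9 edges. -/

/-! ### The registered stubs — ALL DISCHARGED (v1.9): `stub_cutoffData` (P1) and `stub_exteriorCube` (P4) are the
LANDED theorems of `Theorems/QuarterLogPincerTruncationEdge{CutoffData,ExteriorCube}.lean` (imported, same names);
P2 `stub_frameBootstrap` is the LANDED `…TruncationEdgeFrameBootstrap.lean` (this line's v1.6 proof re-homed by the typer), the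
P3b′ ⇒ P3b integration is the LANDED `…TruncationEdgeProfileIntegration.lean` (v1.7 re-homed); P3a `stub_supShadowingCore` and
P3b′ `stub_supShadowingProfile` are LANDED (`…SupShadowingCore.lean`, `…SupShadowingProfile.lean` = v1.5 / v1.8 re-homed); no `sorry` in this file -/

/-- P3b — localisation + log-cube: **DERIVED in v1.7** from P3b′ by the PROVED profile integration
`supShadowingLocal_of_profile` (name kept so the composition is unchanged). [this file; line object — derived] -/
theorem stub_supShadowingLocal : StubSupShadowingLocal :=
  stubSupShadowingLocal_of_profile stub_supShadowingProfile

/-! ### Assembly of the truncated family from the parts (PROVED) -/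

/-! ### THE EDGE: the crux implies the envelope-class Liouville statement (PROVED modulo T1/T3/T4) -/

/-! ### (E1⁺) of crux 23843's factorisation from 24077 -/

/-! ### The registered skeleton's composition, in `stub → … → target` shape -/

/-- v1.2: with T3 proved, THE EDGE modulo T1 and T4 only: 24077 ⇒ item 22144 BY NAME. [this file; line theorem] -/
theorem finiteDissipationLiouville_of_typeIQuantSubcubicExp₂ (hT1 : StubFarFieldTruncation)
    (hT4 : StubRateFloor)
    (h : Summit.NavierStokesRegularity.NavierStokesRegularity.Theses.QuarterLogPincer.TypeIQuantSubcubicExp) :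
    Summit.NavierStokesRegularity.NavierStokesRegularity.Theses.LerayQuarterDissipation.FiniteDissipationLiouville :=
  finiteDissipationLiouville_of_typeIQuantSubcubicExp hT1 stub_envelopeCubeBudget hT4 h

/-- v1.2: (E1⁺) of 23843 from 24077 modulo T1 and T4 only. [this file; line theorem] -/
theorem noEnvelopedLeaf_of_typeIQuantSubcubicExp₂ (hT1 : StubFarFieldTruncation) (hT4 : StubRateFloor)
    (h : Summit.NavierStokesRegularity.NavierStokesRegularity.Theses.QuarterLogPincer.TypeIQuantSubcubicExp)
    (M A : ℝ) : ¬ EnvelopedLeaf M A :=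
  noEnvelopedLeaf_of_typeIQuantSubcubicExp hT1 stub_envelopeCubeBudget hT4 h M A

/-! ### v1.3: THE EDGE MODULO T1 ONLY (T3 and T4 proved) -/

/-! ### v1.4: THE EDGE MODULO THE FOUR PIECES OF T1'S ANATOMY -/

/-- v1.4: composition BY NAME over the four registered pieces: P1 → P2 → P3 → P4 → (24077 → 22144).
[this file; line theorem] -/
theorem FiniteDissipationLiouville_of₀ :
    StubCutoffData → StubFrameBootstrap → StubSupShadowing → StubExteriorCube →
      Summit.NavierStokesRegularity.NavierStokesRegularity.Theses.QuarterLogPincer.TypeIQuantSubcubicExp →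
      Summit.NavierStokesRegularity.NavierStokesRegularity.Theses.LerayQuarterDissipation.FiniteDissipationLiouville :=
  fun h1 h2 h3 h4 => finiteDissipationLiouville_of_typeIQuantSubcubicExp₁
    (stubFarFieldTruncation_of_anatomy h1 h2 h3 h4)

/-- v1.4: the envelope-class Type-I Liouville statement from 24077, modulo P1–P4. [this file; line theorem] -/
theorem envelopeLiouville_of_typeIQuantSubcubicExp₀ (h1 : StubCutoffData) (h2 : StubFrameBootstrap)
    (h3 : StubSupShadowing) (h4 : StubExteriorCube)
    (h : Summit.NavierStokesRegularity.NavierStokesRegularity.Theses.QuarterLogPincer.TypeIQuantSubcubicExp) :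
    ∀ (C A : ℝ) (w : ℝ → EuclideanSpace ℝ (Fin 3) → EuclideanSpace ℝ (Fin 3)),
      IsTypeIAncientMild C w → HasTypeIDecay A w →
      ¬ (∀ r > 0, ∀ M : ℝ, ∃ t ∈ Ioo (-(r ^ 2)) (0 : ℝ),
          ∃ x ∈ ball (0 : EuclideanSpace ℝ (Fin 3)) r, M < ‖w t x‖) :=
  envelopeLiouville_of_typeIQuantSubcubicExp₁ (stubFarFieldTruncation_of_anatomy h1 h2 h3 h4) h

/-- v1.4: THE INSTRUMENT ROW modulo P1–P4 — any Type-I (rotated) `λ`-DSS profile refutes 24077, given the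
four standard pieces. [this file; line theorem] -/
theorem not_typeIQuantSubcubicExp_of_isTypeIDSSProfile₀ (h1 : StubCutoffData) (h2 : StubFrameBootstrap)
    (h3 : StubSupShadowing) (h4 : StubExteriorCube) {c : ℝ}
    {R : EuclideanSpace ℝ (Fin 3) ≃ₗᵢ[ℝ] EuclideanSpace ℝ (Fin 3)}
    {u : ℝ → EuclideanSpace ℝ (Fin 3) → EuclideanSpace ℝ (Fin 3)} (hu : IsTypeIDSSProfile c R u) :
    ¬ Summit.NavierStokesRegularity.NavierStokesRegularity.Theses.QuarterLogPincer.TypeIQuantSubcubicExp :=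
  not_typeIQuantSubcubicExp_of_isTypeIDSSProfile₁ (stubFarFieldTruncation_of_anatomy h1 h2 h3 h4) hu

/-! ### v1.9: THE EDGE WITH NO SIDE OBLIGATION (T1 proved above; T3, T4 landed) -/

/-- **v1.9 — an enveloped singular Type-I ancient mild object refutes the crux 24077**, with no side
obligation (T1 = `stub_farFieldTruncation` proved, T3/T4 landed). [this file; line theorem — PROVED] -/
theorem envelopedSingular_refutes_typeIQuantSubcubicExp {M A : ℝ}
    {v : ℝ → EuclideanSpace ℝ (Fin 3) → EuclideanSpace ℝ (Fin 3)}
    (hv : IsTypeIAncientMild M v) (hdec : HasTypeIDecay A v) (hsing : SingularAt v 0) :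
    ¬ Summit.NavierStokesRegularity.NavierStokesRegularity.Theses.QuarterLogPincer.TypeIQuantSubcubicExp :=
  not_typeIQuantSubcubicExp_of_envelopedSingular stub_farFieldTruncation stub_envelopeCubeBudget
    stub_rateFloor hv hdec hsing

/-- **v1.9 — THE EDGE, obligation-free: 24077 ⇒ the envelope-class Type-I Liouville statement**
(every Type-I ancient mild field in the KNSS gauge with a KNSS space–time envelope is regular at the
apex). [this file; line theorem — PROVED] -/
theorem typeIQuantSubcubicExp_implies_envelopeLiouville (h : Summit.NavierStokesRegularity.NavierStokesRegularity.Theses.QuarterLogPincer.TypeIQuantSubcubicExp) :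
    ∀ (C A : ℝ) (w : ℝ → EuclideanSpace ℝ (Fin 3) → EuclideanSpace ℝ (Fin 3)),
      IsTypeIAncientMild C w → HasTypeIDecay A w →
      ¬ (∀ r > 0, ∀ M : ℝ, ∃ t ∈ Ioo (-(r ^ 2)) (0 : ℝ),
          ∃ x ∈ ball (0 : EuclideanSpace ℝ (Fin 3)) r, M < ‖w t x‖) :=
  envelopeLiouville_of_typeIQuantSubcubicExp stub_farFieldTruncation stub_envelopeCubeBudget
    stub_rateFloor h

/-- **v1.9 — 24077 ⇒ 22144** (`LerayQuarterDissipation.FiniteDissipationLiouville` BY NAME), obligation-free.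
[this file; line theorem — PROVED] -/
theorem typeIQuantSubcubicExp_implies_finiteDissipationLiouville (h : Summit.NavierStokesRegularity.NavierStokesRegularity.Theses.QuarterLogPincer.TypeIQuantSubcubicExp) :
    Summit.NavierStokesRegularity.NavierStokesRegularity.Theses.LerayQuarterDissipation.FiniteDissipationLiouville :=
  finiteDissipationLiouville_of_typeIQuantSubcubicExp stub_farFieldTruncation stub_envelopeCubeBudget
    stub_rateFloor h

/-- **v1.9 — 24077 ⇒ «no enveloped thin object»**, obligation-free. [this file; line theorem — PROVED] -/
theorem typeIQuantSubcubicExp_implies_envelopedThinLiouville (h : Summit.NavierStokesRegularity.NavierStokesRegularity.Theses.QuarterLogPincer.TypeIQuantSubcubicExp) :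
    ∀ (M q A : ℝ) (v : ℝ → EuclideanSpace ℝ (Fin 3) → EuclideanSpace ℝ (Fin 3))
      (g : EuclideanSpace ℝ (Fin 3) → EuclideanSpace ℝ (Fin 3)),
      ThinObject M q v g → HasTypeIDecay A v → False :=
  envelopedThinLiouville_of_typeIQuantSubcubicExp stub_farFieldTruncation stub_envelopeCubeBudget
    stub_rateFloor h

/-- **v1.9 — 24077 ⇒ 24453** (`CalmSliceGate.AsymmetricFlickerLiouville` BY NAME), obligation-free.
[this file; line theorem — PROVED] -/
theorem typeIQuantSubcubicExp_implies_asymmetricFlickerLiouville (h : Summit.NavierStokesRegularity.NavierStokesRegularity.Theses.QuarterLogPincer.TypeIQuantSubcubicExp) :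
    Summit.NavierStokesRegularity.NavierStokesRegularity.Theses.CalmSliceGate.AsymmetricFlickerLiouville :=
  asymmetricFlickerLiouville_of_typeIQuantSubcubicExp stub_farFieldTruncation stub_envelopeCubeBudget
    stub_rateFloor h

/-- **v1.9 — 24077 ⇒ 24374** (`CalmSliceGate.PerpetualFlickerLiouville` BY NAME), obligation-free.
[this file; line theorem — PROVED] -/
theorem typeIQuantSubcubicExp_implies_perpetualFlickerLiouville (h : Summit.NavierStokesRegularity.NavierStokesRegularity.Theses.QuarterLogPincer.TypeIQuantSubcubicExp) :
    Summit.NavierStokesRegularity.NavierStokesRegularity.Theses.CalmSliceGate.PerpetualFlickerLiouville :=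
  perpetualFlickerLiouville_of_typeIQuantSubcubicExp stub_farFieldTruncation stub_envelopeCubeBudget
    stub_rateFloor h

/-- **v1.9 — 24077 ⇒ the catalogued DSS wall `TypeIDSSLiouvilleConjecture`** (plain and rotated, every
`λ`), obligation-free. [this file; line theorem — PROVED] -/
theorem typeIQuantSubcubicExp_implies_typeIDSSLiouvilleConjecture (h : Summit.NavierStokesRegularity.NavierStokesRegularity.Theses.QuarterLogPincer.TypeIQuantSubcubicExp) :
    _root_.Summit.NavierStokesRegularity.NavierStokesRegularity.TypeIDSSLiouvilleConjecture :=
  typeIDSSLiouvilleConjecture_of_typeIQuantSubcubicExp stub_farFieldTruncation stub_envelopeCubeBudget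
    stub_rateFloor h

/-- **v1.9 — 24077 ⇒ `TypeIDSSLiouville λ`, every `λ`**, obligation-free. [this file; line theorem — PROVED] -/
theorem typeIQuantSubcubicExp_implies_typeIDSSLiouville (h : Summit.NavierStokesRegularity.NavierStokesRegularity.Theses.QuarterLogPincer.TypeIQuantSubcubicExp) (c : ℝ) : TypeIDSSLiouville c :=
  typeIDSSLiouville_of_typeIQuantSubcubicExp stub_farFieldTruncation stub_envelopeCubeBudget
    stub_rateFloor h c

/-- **v1.9 — THE INSTRUMENT ROW AS AN OBLIGATION-FREE THEOREM**: any Type-I (rotated) `λ`-DSS profile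
refutes the crux 24077.  (So a backward-DSS profile found by the census would now kill 24077 itself, not
only the line through S3.) [this file; line theorem — PROVED] -/
theorem isTypeIDSSProfile_refutes_typeIQuantSubcubicExp {c : ℝ}
    {R : EuclideanSpace ℝ (Fin 3) ≃ₗᵢ[ℝ] EuclideanSpace ℝ (Fin 3)}
    {u : ℝ → EuclideanSpace ℝ (Fin 3) → EuclideanSpace ℝ (Fin 3)} (hu : IsTypeIDSSProfile c R u) :
    ¬ Summit.NavierStokesRegularity.NavierStokesRegularity.Theses.QuarterLogPincer.TypeIQuantSubcubicExp :=
  not_typeIQuantSubcubicExp_of_isTypeIDSSProfile stub_farFieldTruncation stub_envelopeCubeBudget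
    stub_rateFloor hu

/-- **v1.9 — (E1⁺) of crux 23843's factorisation from 24077**, obligation-free: `¬ EnvelopedLeaf M A` for
all `M, A`. [this file; line theorem — PROVED] -/
theorem typeIQuantSubcubicExp_implies_noEnvelopedLeaf (h : Summit.NavierStokesRegularity.NavierStokesRegularity.Theses.QuarterLogPincer.TypeIQuantSubcubicExp) :
    ∀ M A : ℝ, ¬ EnvelopedLeaf M A :=
  noEnvelopedLeaf_of_typeIQuantSubcubicExp stub_farFieldTruncation stub_envelopeCubeBudget
    stub_rateFloor h

end Summit.NavierStokesRegularity.NavierStokesRegularity.Cruxes.TypeIQuantSubcubicExp.TruncationEdge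

end
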